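import Summits.Ventures.CertifiedQuantumChemistry.Certificates.HubbardRingL4SectorDQGDualBlockDudB
import Summits.Ventures.CertifiedQuantumChemistry.Certificates.HubbardRingL4SectorDQGDualBlockQudB
import Summits.Ventures.CertifiedQuantumChemistry.Certificates.HubbardRingL4SectorDQGDualBlockG0D
import Summits.Ventures.CertifiedQuantumChemistry.Certificates.HubbardRingL4SectorDQGDualBlockGudB
import Summits.Ventures.CertifiedQuantumChemistry.Certificates.HubbardRingL4SectorDQGDualBlockGduB
import Summits.Ventures.CertifiedQuantumChemistry.Certificates.HubbardRingL4SectorDQGDualBlockLikeD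
import Summits.Ventures.CertifiedQuantumChemistry.Certificates.HubbardRingL4SectorDQGDualBlockLikeQ
import Summits.Ventures.CertifiedQuantumChemistry.Certificates.HubbardRingL4SectorDQGDualMult
import Summits.Ventures.CertifiedQuantumChemistry.Certificates.HubbardRingL4SectorDualPair
import HarnessLib

/-!
# Ventures/CertifiedQuantumChemistry — Certificates/HubbardRingL4SectorDQGDualFamily.lean: the per-order `Dual` records (rational part `dualR`, `√2` part
# `dualS`) of the explicit finite-`U` dual certificate family for the `(2,2)`-SECTOR (level-DQG) programme of the Hubbard 4-ring over `ℚ(√2)`,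
# and the positive semidefiniteness of its three COMBINED `ε`-tables

HONEST FRAMING (verbatim): certified bounds for a stated model Hamiltonian in a stated basis; not a claim about the real molecule beyond that model. An AUXILIARY dual object; no model value, no row, no claim node.

Seat rdm-B (gen 45; certificate `tools/x14-g45/dual4dqg/cert_J1.json` sha256 c2c86168358174db…). `dualR m` / `dualS m` (`m < 5`)
assemble the order-`m` tables of the nine dual blocks (`…Block{Dud,Qud,G0,Gud,Gdu}{A,B,…}`, `…BlockLike{D,Q}`: scattered into the
`64 × 64` index set with gen 44's labels `Singlet.labUD/labDU/labG0/posUD/posG0` and the like-spin labels `labUU/labDD` of this file) and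
the order-`m` multipliers / target of `…Mult.lean`; the exchange-row multiplier is `0` (plain `S_z`-sector programme). **`posSemidef_zD_pair`,
`posSemidef_zQ_pair`, `posSemidef_zG_pair`**: for every rational `ε` the combined real tables `realZ (polyDual dualR ε).z• + √2 •
realZ (polyDual dualS ε).z•` are positive semidefinite (sums of scattered block families `S(ε)(P_r + √2P_s)S(ε)ᵀ ⪰ 0`,
`DualL4.posSemidef_realZ_pair_scatter`). The per-order checks are the ten companion files `…Check{R,S}{0…4}.lean`.
0 sorry; small `def`s (`labUU`, `labDD`, `dualR`, `dualS`); standard axioms.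
-/

set_option linter.style.longLine false

namespace Summit.Ventures.CertifiedQuantumChemistry

namespace DualL4.SectorDQG

open Matrix Finset BlockScatter
open Literature.MathematicalPhysics.QuantumLattice

/-- Block label of the like-spin `(↑,↑)` pair codes. -/
def labUU (P : OP) : ℕ := if sp P.1 = 0 ∧ sp P.2 = 0 then 1 else 0
/-- Block label of the like-spin `(↓,↓)` pair codes. -/
def labDD (P : OP) : ℕ := if sp P.1 = 1 ∧ sp P.2 = 1 then 1 else 0

/-- The order-`m` record of the RATIONAL part of the family (`m < 5`). -/
noncomputable def dualR (m : Fin 5) : Dual where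
  zD := fun P R => scatter 16 Singlet.labUD Singlet.posUD 1 (trDud m) P R + scatter 16 labUU Singlet.posUD 1 (trDuu m) P R
    + scatter 16 labDD Singlet.posUD 1 (trDdd m) P R
  zQ := fun P R => scatter 16 Singlet.labUD Singlet.posUD 1 (trQud m) P R + scatter 16 labUU Singlet.posUD 1 (trQuu m) P R
    + scatter 16 labDD Singlet.posUD 1 (trQdd m) P R
  zG := fun P R => scatter 32 Singlet.labG0 Singlet.posG0 1 (trG0 m) P R + scatter 16 Singlet.labUD Singlet.posUD 1 (trGud m) P R
    + scatter 16 Singlet.labDU Singlet.posUD 1 (trGdu m) P R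
  nu := fun x y τ => nuTabR m (DQGGap.eOrb x) (DQGGap.eOrb y) τ
  tOne := tOneR m
  tUp := tUpR m
  tDn := tDnR m
  tUU := tUUR m
  tDD := tDDR m
  tUD := tUDR m
  xi := 0
  cd := cdR m
  ch := chR m
  mu := muR m

/-- The order-`m` record of the `√2` part of the family (`m < 5`). -/
noncomputable def dualS (m : Fin 5) : Dual where
  zD := fun P R => scatter 16 Singlet.labUD Singlet.posUD 1 (tsDud m) P R + scatter 16 labUU Singlet.posUD 1 (tsDuu m) P R
    + scatter 16 labDD Singlet.posUD 1 (tsDdd m) P R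
  zQ := fun P R => scatter 16 Singlet.labUD Singlet.posUD 1 (tsQud m) P R + scatter 16 labUU Singlet.posUD 1 (tsQuu m) P R
    + scatter 16 labDD Singlet.posUD 1 (tsQdd m) P R
  zG := fun P R => scatter 32 Singlet.labG0 Singlet.posG0 1 (tsG0 m) P R + scatter 16 Singlet.labUD Singlet.posUD 1 (tsGud m) P R
    + scatter 16 Singlet.labDU Singlet.posUD 1 (tsGdu m) P R
  nu := fun x y τ => nuTabS m (DQGGap.eOrb x) (DQGGap.eOrb y) τ
  tOne := tOneS m
  tUp := tUpS m
  tDn := tDnS m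
  tUU := tUUS m
  tDD := tDDS m
  tUD := tUDS m
  xi := 0
  cd := cdS m
  ch := chS m
  mu := muS m

/-! ## Positivity of the combined `ε`-tables -/

/-- Splitting a combined table built from three scattered families into the three combined scatters. -/
private theorem realZ_pair_three {k₁ k₂ k₃ : ℕ} (l₁ p₁ l₂ p₂ l₃ p₃ : OP → ℕ) (A₁ B₁ : Fin 5 → Matrix (Fin k₁) (Fin k₁) ℚ)
    (A₂ B₂ : Fin 5 → Matrix (Fin k₂) (Fin k₂) ℚ) (A₃ B₃ : Fin 5 → Matrix (Fin k₃) (Fin k₃) ℚ) (ε : ℚ) :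
    Dual.realZ (fun P R => ∑ m : Fin 5, ε ^ (m : ℕ) *
        (scatter k₁ l₁ p₁ 1 (A₁ m) P R + scatter k₂ l₂ p₂ 1 (A₂ m) P R + scatter k₃ l₃ p₃ 1 (A₃ m) P R))
      + Real.sqrt 2 • Dual.realZ (fun P R => ∑ m : Fin 5, ε ^ (m : ℕ) *
        (scatter k₁ l₁ p₁ 1 (B₁ m) P R + scatter k₂ l₂ p₂ 1 (B₂ m) P R + scatter k₃ l₃ p₃ 1 (B₃ m) P R)) =
    (Dual.realZ (fun P R => ∑ m : Fin 5, ε ^ (m : ℕ) * scatter k₁ l₁ p₁ 1 (A₁ m) P R)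
        + Real.sqrt 2 • Dual.realZ (fun P R => ∑ m : Fin 5, ε ^ (m : ℕ) * scatter k₁ l₁ p₁ 1 (B₁ m) P R))
      + (Dual.realZ (fun P R => ∑ m : Fin 5, ε ^ (m : ℕ) * scatter k₂ l₂ p₂ 1 (A₂ m) P R)
        + Real.sqrt 2 • Dual.realZ (fun P R => ∑ m : Fin 5, ε ^ (m : ℕ) * scatter k₂ l₂ p₂ 1 (B₂ m) P R))
      + (Dual.realZ (fun P R => ∑ m : Fin 5, ε ^ (m : ℕ) * scatter k₃ l₃ p₃ 1 (A₃ m) P R)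
        + Real.sqrt 2 • Dual.realZ (fun P R => ∑ m : Fin 5, ε ^ (m : ℕ) * scatter k₃ l₃ p₃ 1 (B₃ m) P R)) := by
  ext P R
  simp only [Dual.realZ, Matrix.of_apply, Matrix.add_apply, Matrix.smul_apply, smul_eq_mul, mul_add, Finset.sum_add_distrib]
  push_cast
  ring

/-- **`zD_r(ε) + √2·zD_s(ε) ⪰ 0`** for every rational `ε`. -/
theorem posSemidef_zD_pair (ε : ℚ) :
    (Dual.realZ (polyDual dualR ε).zD + Real.sqrt 2 • Dual.realZ (polyDual dualS ε).zD).PosSemidef := by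
  have eR : (polyDual dualR ε).zD = fun P R => ∑ m : Fin 5, ε ^ (m : ℕ) *
      (scatter 16 Singlet.labUD Singlet.posUD 1 (trDud m) P R + scatter 16 labUU Singlet.posUD 1 (trDuu m) P R
        + scatter 16 labDD Singlet.posUD 1 (trDdd m) P R) := rfl
  have eS : (polyDual dualS ε).zD = fun P R => ∑ m : Fin 5, ε ^ (m : ℕ) *
      (scatter 16 Singlet.labUD Singlet.posUD 1 (tsDud m) P R + scatter 16 labUU Singlet.posUD 1 (tsDuu m) P R
        + scatter 16 labDD Singlet.posUD 1 (tsDdd m) P R) := rfl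
  rw [eR, eS, realZ_pair_three]
  exact ((posSemidef_realZ_pair_scatter _ _ _ _ posSemidef_realT_pair_Dud ε).add
    (posSemidef_realZ_pair_scatter _ _ _ _ posSemidef_realT_pair_Duu ε)).add
    (posSemidef_realZ_pair_scatter _ _ _ _ posSemidef_realT_pair_Ddd ε)

/-- **`zG_r(ε) + √2·zG_s(ε) ⪰ 0`** for every rational `ε`. -/
theorem posSemidef_zG_pair (ε : ℚ) :
    (Dual.realZ (polyDual dualR ε).zG + Real.sqrt 2 • Dual.realZ (polyDual dualS ε).zG).PosSemidef := by
  have eR : (polyDual dualR ε).zG = fun P R => ∑ m : Fin 5, ε ^ (m : ℕ) *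
      (scatter 32 Singlet.labG0 Singlet.posG0 1 (trG0 m) P R + scatter 16 Singlet.labUD Singlet.posUD 1 (trGud m) P R
        + scatter 16 Singlet.labDU Singlet.posUD 1 (trGdu m) P R) := rfl
  have eS : (polyDual dualS ε).zG = fun P R => ∑ m : Fin 5, ε ^ (m : ℕ) *
      (scatter 32 Singlet.labG0 Singlet.posG0 1 (tsG0 m) P R + scatter 16 Singlet.labUD Singlet.posUD 1 (tsGud m) P R
        + scatter 16 Singlet.labDU Singlet.posUD 1 (tsGdu m) P R) := rfl
  rw [eR, eS, realZ_pair_three]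
  exact ((posSemidef_realZ_pair_scatter _ _ _ _ posSemidef_realT_pair_G0 ε).add
    (posSemidef_realZ_pair_scatter _ _ _ _ posSemidef_realT_pair_Gud ε)).add
    (posSemidef_realZ_pair_scatter _ _ _ _ posSemidef_realT_pair_Gdu ε)


/-- **`zQ_r(ε) + √2·zQ_s(ε) ⪰ 0`** for every rational `ε`. -/
theorem posSemidef_zQ_pair (ε : ℚ) :
    (Dual.realZ (polyDual dualR ε).zQ + Real.sqrt 2 • Dual.realZ (polyDual dualS ε).zQ).PosSemidef := by
  have eR : (polyDual dualR ε).zQ = fun P R => ∑ m : Fin 5, ε ^ (m : ℕ) *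
      (scatter 16 Singlet.labUD Singlet.posUD 1 (trQud m) P R + scatter 16 labUU Singlet.posUD 1 (trQuu m) P R
        + scatter 16 labDD Singlet.posUD 1 (trQdd m) P R) := rfl
  have eS : (polyDual dualS ε).zQ = fun P R => ∑ m : Fin 5, ε ^ (m : ℕ) *
      (scatter 16 Singlet.labUD Singlet.posUD 1 (tsQud m) P R + scatter 16 labUU Singlet.posUD 1 (tsQuu m) P R
        + scatter 16 labDD Singlet.posUD 1 (tsQdd m) P R) := rfl
  rw [eR, eS, realZ_pair_three]
  exact ((posSemidef_realZ_pair_scatter _ _ _ _ posSemidef_realT_pair_Qud ε).add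
    (posSemidef_realZ_pair_scatter _ _ _ _ posSemidef_realT_pair_Quu ε)).add
    (posSemidef_realZ_pair_scatter _ _ _ _ posSemidef_realT_pair_Qdd ε)

end DualL4.SectorDQG

end Summit.Ventures.CertifiedQuantumChemistry
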